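import Summits.HodgeConjecture.HodgeConjecture.Theorems.Ring2AbelianAllAndreProductPencils
import Summits.HodgeConjecture.HodgeConjecture.Theorems.Ring2AbelianAllAndreInvariantHomNumDivision
import Summits.HodgeConjecture.HodgeConjecture.Theorems.Ring2AbelianAllAndreFibreClassDivisionRungs
import Summits.HodgeConjecture.HodgeConjecture.Theorems.Ring2AbelianAllAndrePrimitiveLift
import Summits.HodgeConjecture.HodgeConjecture.Theorems.Ring2AbelianAllAndreSpreadVerdierGraded
import Summits.HodgeConjecture.HodgeConjecture.Theorems.Ring2AbelianAllSpreadFloorHeredity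
import Summits.HodgeConjecture.HodgeConjecture.Theorems.Ring2BindersAbelianSchemeVHCShadow
import HarnessLib

/-!
# Ring 2 · sub-cell AbelianAll (ALL ABELIAN VARIETIES), André axis, part XXXII-b — THE ANDRÉ-AXIS NODES ARE THEIR MIDDLE
# FIBRE DEGREE: (L) `CMFibreAlgebraicLift`, (L∀) `AlgebraicFixedPart`, (4) `CMAnchoredTransport`, (2) `CompactAbelianPencilVHC`,
# (3) `CMPointedPencilVHC` are each FACT-FREE EQUIVALENT to their restriction to the middle degree `H^{2m}` of compact pencils
# of abelian varieties of EVEN relative dimension `2m ≥ 4` (part XXXII-c: the cell rows in this form, the verbatim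
# restrictions, and where the content starts — the cell `(6, 3)` modulo [Verdier, Moonen–Zarhin, Markman])

HONEST FRAMING (page 1, verbatim): **research route, not a corollary; conditional on HC_CM plus one named
minimal statement.** Cell line: research route conditional on HC_CM; not a corollary; Q11.4-sentence-2 already
refuted in dim ≥ 3. Nothing in this file proves a case of the Hodge conjecture for an abelian variety; `HC_CM`, `HC_AV` do
not occur; the reduction item `CMToAbelian` (stmt-16267) is NOT closed; the cell's `B_min` of record (N104) is untouched; NO
node is born: the middle-degree forms are FILE-LOCAL NOTATIONS (`LiftMid[k]`, `FixedPartMid[k]`, `TransportMid[k]`,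
`VHCMid[k]`, `PointedVHCMid[k]`), symbol for symbol the lattice / complex bodies of the nodes (parts XVII-b, IX) with the
binders `d = 2m`, `k ≤ m`, `p = m` inserted; nothing is claimed minimal; 0 `def`, 0 `sorry`, no named fact, axioms standard.

## What this part does (brief (ii): "restrict the class of auxiliary varieties; replace B by specific components")

Part XXXII-a's Gysin padding (`σ_!` / `pr_!` along `B × 𝒳 ⟶ S`, both base changes PROVED in the tree) moves the lift and the
transport statements of a pencil `f` in degree `2p`, `2p < d`, to the SAME statements of the product pencil `B × 𝒳 ⟶ S` in
degree `2(p + dim B)` — the middle degree when `dim B = d - 2p` — and `B × 𝒳 ⟶ S` is again a compact pencil of abelian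
varieties, CM-pointed where `f` is when `B` is of CM type (a power of `y² = x³ + x`, `exists_isOfCMType_dim_eq_succ`) (§1).
Above the middle, the lift moves up by part XXX-b (`comap_le_sup_compl_of_le'`, Lieberman on the fibre) and the transport by
seat b02's LOWER SHADOW (`Ring2.Binders.map_fiberι_mem_algebraicClasses_of_lowerHalf`: one global polarising class, the
theorem of the fixed part, `B(𝒳_s)` — fact-free on the projective carriers of compact pencils); `p ≤ 1` is parts XXIX–XXX.
Hence, all FACT-FREE:

* §2 `cmFibreAlgebraicLift_iff_liftMid` — **(L) ⟺ (L)^mid**: the specialisation surjectivity `Aᵖ(𝒳) ↠ Aᵖ(𝒳_t)^{inv}` at CM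
  fibres of all compact pencils in all degrees ⟺ the same for MIDDLE-dimensional classes of CM fibres of compact pencils of
  even relative dimension `2m ≥ 4` ("find the cycle on the `(2m+1)`-fold lifting a middle-dimensional invariant algebraic class
  of a CM fibre"); `algebraicFixedPart_iff_fixedPartMid` — **(L∀) ⟺ (L∀)^mid**;
* §3 `cmAnchoredTransport_iff_transportMid` — **(4) ⟺ (4)^mid**; `compactAbelianPencilVHC_iff_vhcMid` — **(2) ⟺ (2)^mid**
  (the compact-pencil, residual-free twin of b02's `abelianSchemeVHC_iff_middleDegree_of_raynaud1970`);
  `cmPointedPencilVHC_iff_pointedVHCMid` — **(3) ⟺ (3)^mid**.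

COMPARISON WITH THE OTHER AXES. On the SPREADING axis, node-to-node, only `F_CM ⟹ F_CM^mid` is fact-free (spread part XXIV), so
N104 `F_CM^mid` is a possibly smaller node; instance-wise the two agree AT AND ABOVE the middle by ab-spread-1's PULL-BACK padding
(`c' := pr_A^* c` on `A × B`, read back through the anchored datum's comparison homomorphism: `F_CM^mid ⟺ F_CM^{≥mid}`,
`N1 ⟺ N104 ∧ F_CM^{<mid}`, their part XXXII) and differ only STRICTLY BELOW the middle, where the Gysin padding `σ_!` of THIS
axis (read back by `pr_!`) has no pull-back counterpart (a pull-back along `A ⟶ B × A` kills `σ_! c`); on THIS axis the nodes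
quantify over ALL compact pencils and the padded pencil is available, so the middle restriction is an EQUIVALENT FORM in every
degree, not a new candidate (no node filed). Seat b02's pull-back padding `pr^*(Kʳ ∪ W)` cannot carry the LIFT form
down (inverting `Kʳ ∪ –` on invariant classes relative to `S` is the content of parts XXIII–XXVIII); the Gysin padding can,
because `pr_! σ_! = id`.

What is NOT claimed: that any single cell `(2m, m)` suffices; any pointwise converse for a fixed pencil; anything minimal;
any case of HC. EDGE LABELS: every row K (kernel, fact-free).

References: Andre1996Motifs (§5.1 p. 25; §6.3 Lemme 6.3.1 p. 31, a) and Remarque 2 p. 33); Milne2020HodgeClassesAV (Prop. 1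
p. 7); Abdulali1994FamiliesAV ((1.1) p. 1122, Lemma 6.2 p. 1131); BrosnanFangNiePearlstein2009 (§6 Lemma 48); Fulton1998
(Prop. 1.7, Thm. 6.2 (a)); Lieberman1968 (Thm. 1); Kleiman1968AlgebraicCycles (§2 Thm. 2A11); VoisinHodgeII2003 (Thm. 4.18,
§9.2.4); KerrPearlstein2011 (§3.1); CharlesSchnell2014Notes (Cor. 11.3.6); GrothendieckTopology1969 (§1).
-/

noncomputable section

set_option linter.dupNamespace false

namespace Summit.HodgeConjecture.HodgeConjecture.Ring2.AbelianAll

open CategoryTheory CategoryTheory.Limits AlgebraicGeometry MonoidalCategory CartesianMonoidalCategory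
open Literature.AlgebraicGeometry Literature.AlgebraicGeometry.Motives
open Literature.AlgebraicGeometry.HodgeTheory
open Literature.AlgebraicGeometry.Deligne1982 (cmLocus)
open Literature.AlgebraicGeometry.Milne1999 (IsOfCMType)
open Literature.AlgebraicGeometry.Abdulali1994 (InvariantCyclesHoldFor)
open Literature.AlgebraicGeometry.Andre1996 (andre1996_cmAnchoredPencil
  andre1996_cmHodgeClasses_algebraicallyAnchoredPencils)
open Summit.HodgeConjecture.HodgeConjecture
open Summit.HodgeConjecture.HodgeConjecture.Theses
open Summit.HodgeConjecture.HodgeConjecture.Ring2.Deform (CompactAbelianPencilVHC HC_CM_of_HC_AV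
  HC_CM_of_andre1996_of_compactAbelianPencilVHC compactAbelianPencilVHC_of_HC_AV)
open Summit.HodgeConjecture.HodgeConjecture.Ring2.ClassTargets (HCAtDim hcAtDim_four_of_weilClassesFourfolds)

variable {𝒳 S : SchemeOver ℂ}

/-! ## §0 The middle-degree forms (file-local notations; nothing is defined or asserted) -/

/-- `(L)^mid_{≥k}` — the lift node (L) `CMFibreAlgebraicLift` in lattice form, RESTRICTED to the middle degree `2m` of compact
pencils of abelian varieties of even relative dimension `2m`, `k ≤ m` (file-local notation). -/
local notation3 (prettyPrint := false) "LiftMid[" k "]" =>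
  ∀ ⦃m : ℕ⦄ ⦃𝒳 S : SchemeOver ℂ⦄ (f : 𝒳 ⟶ S), IsCompactAbelianPencil f (2 * m) → k ≤ m →
    ∀ t ∈ cmLocus f (2 * m),
      (algebraicClasses (fiberOver f t) m).comap (complexBetti.map (fiberι f t) (2 * m)).hom ≤
        algebraicClasses 𝒳 m ⊔ LinearMap.ker (complexBetti.map (fiberι f t) (2 * m)).hom

/-- `(L∀)^mid_{≥k}` — the algebraic fixed part `AlgebraicFixedPart` in lattice form, restricted to the middle degree of
compact pencils of even relative dimension `2m`, `k ≤ m`, at EVERY point (file-local notation). -/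
local notation3 (prettyPrint := false) "FixedPartMid[" k "]" =>
  ∀ ⦃m : ℕ⦄ ⦃𝒳 S : SchemeOver ℂ⦄ (f : 𝒳 ⟶ S), IsCompactAbelianPencil f (2 * m) → k ≤ m →
    ∀ t : ComplexPoints S,
      (algebraicClasses (fiberOver f t) m).comap (complexBetti.map (fiberι f t) (2 * m)).hom ≤
        algebraicClasses 𝒳 m ⊔ LinearMap.ker (complexBetti.map (fiberι f t) (2 * m)).hom

/-- `(4)^mid_{≥k}` — CM-anchored transport `CMAnchoredTransport` on complex cohomology, restricted to the middle degree of
compact pencils of even relative dimension `2m`, `k ≤ m` (file-local notation). -/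
local notation3 (prettyPrint := false) "TransportMid[" k "]" =>
  ∀ ⦃m : ℕ⦄ ⦃𝒳 S : SchemeOver ℂ⦄ (f : 𝒳 ⟶ S), IsCompactAbelianPencil f (2 * m) → k ≤ m →
    ∀ (W : complexBetti 𝒳 (2 * m)), ∀ t ∈ cmLocus f (2 * m),
      complexBetti.map (fiberι f t) (2 * m) W ∈ algebraicClasses (fiberOver f t) m →
      ∀ s : ComplexPoints S, complexBetti.map (fiberι f s) (2 * m) W ∈ algebraicClasses (fiberOver f s) m

/-- `(2)^mid_{≥k}` — deform's `CompactAbelianPencilVHC` on complex cohomology, restricted to the middle degree of compact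
pencils of even relative dimension `2m`, `k ≤ m` (file-local notation). -/
local notation3 (prettyPrint := false) "VHCMid[" k "]" =>
  ∀ ⦃m : ℕ⦄ ⦃𝒳 S : SchemeOver ℂ⦄ (f : 𝒳 ⟶ S), IsCompactAbelianPencil f (2 * m) → k ≤ m →
    ∀ (W : complexBetti 𝒳 (2 * m)),
      (∃ s₀ : ComplexPoints S, complexBetti.map (fiberι f s₀) (2 * m) W ∈ algebraicClasses (fiberOver f s₀) m) →
      ∀ s : ComplexPoints S, complexBetti.map (fiberι f s) (2 * m) W ∈ algebraicClasses (fiberOver f s) m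

/-- `(3)^mid_{≥k}` — `CMPointedPencilVHC` on complex cohomology, restricted to the middle degree of CM-pointed compact
pencils of even relative dimension `2m`, `k ≤ m` (file-local notation). -/
local notation3 (prettyPrint := false) "PointedVHCMid[" k "]" =>
  ∀ ⦃m : ℕ⦄ ⦃𝒳 S : SchemeOver ℂ⦄ (f : 𝒳 ⟶ S), IsCompactAbelianPencil f (2 * m) → k ≤ m →
    (cmLocus f (2 * m)).Nonempty → ∀ (W : complexBetti 𝒳 (2 * m)),
      (∃ s₀ : ComplexPoints S, complexBetti.map (fiberι f s₀) (2 * m) W ∈ algebraicClasses (fiberOver f s₀) m) →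
      ∀ s : ComplexPoints S, complexBetti.map (fiberι f s) (2 * m) W ∈ algebraicClasses (fiberOver f s) m

/-! ## §1 The padding step on compact pencils -/

/-- The product pencil `B × 𝒳 ⟶ S` in a prescribed relative dimension `n = dim B + d`. [folklore] -/
theorem isCompactAbelianPencil_snd_comp_of_eq {d n : ℕ} {f : 𝒳 ⟶ S} (hf : IsCompactAbelianPencil f d)
    (B : AbelianVariety ℂ) (hn : B.dim + d = n) : IsCompactAbelianPencil (snd B.X 𝒳 ≫ f) n :=
  hn ▸ isCompactAbelianPencil_snd_comp hf B

/-- CM points of `f` are CM points of `B × 𝒳 ⟶ S` (`B` of CM type), in a prescribed relative dimension. [folklore] -/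
theorem mem_cmLocus_snd_comp_of_eq {d n : ℕ} (f : 𝒳 ⟶ S) (B : AbelianVariety ℂ) (hB : IsOfCMType B)
    (hn : B.dim + d = n) {t : ComplexPoints S} (ht : t ∈ cmLocus f d) : t ∈ cmLocus (snd B.X 𝒳 ≫ f) n :=
  hn ▸ cmLocus_subset_cmLocus_snd_comp f B hB ht

/-- **Padding, lift form, on a compact pencil**: `(L)_t(p + dim B)` of `B × 𝒳 ⟶ S` gives `(L)_t(p)` of `f` (part XXXII-a
`comap_le_sup_of_snd_comp` with the smooth projective data of the pencil). FACT-FREE. [cite: Fulton1998, Prop. 1.7 and Thm. 6.2 (a)] -/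
theorem comap_le_sup_of_snd_comp' {d : ℕ} {f : 𝒳 ⟶ S} (hf : IsCompactAbelianPencil f d) (B : AbelianVariety ℂ)
    {t : ComplexPoints S} {p : ℕ}
    (h : (algebraicClasses (fiberOver (snd B.X 𝒳 ≫ f) t) (p + B.dim)).comap
        (complexBetti.map (fiberι (snd B.X 𝒳 ≫ f) t) (2 * (p + B.dim))).hom ≤
      algebraicClasses (B.X ⊗ 𝒳) (p + B.dim) ⊔
        LinearMap.ker (complexBetti.map (fiberι (snd B.X 𝒳 ≫ f) t) (2 * (p + B.dim))).hom) :
    (algebraicClasses (fiberOver f t) p).comap (complexBetti.map (fiberι f t) (2 * p)).hom ≤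
      algebraicClasses 𝒳 p ⊔ LinearMap.ker (complexBetti.map (fiberι f t) (2 * p)).hom := by
  haveI : IsProper S.hom := IsSmoothProjective.isProper_holds hf.isSmoothProjective_base
  exact comap_le_sup_of_snd_comp hf.isSmoothProjective_total hf.isSmoothProjectiveFamily
    (AbelianVariety.isSmoothProjective_holds (A := B)) (1 : B.Points ℂ) h

/-- **Padding, transport form, on a compact pencil**: transport from `t` to `s` in degree `2(p + dim B)` along
`B × 𝒳 ⟶ S` gives transport from `t` to `s` in degree `2p` along `f`. FACT-FREE. [cite: Fulton1998, Prop. 1.7 and Thm. 6.2 (a)] -/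
theorem comap_le_comap_of_snd_comp' {d : ℕ} {f : 𝒳 ⟶ S} (hf : IsCompactAbelianPencil f d) (B : AbelianVariety ℂ)
    {t s : ComplexPoints S} {p : ℕ}
    (h : (algebraicClasses (fiberOver (snd B.X 𝒳 ≫ f) t) (p + B.dim)).comap
        (complexBetti.map (fiberι (snd B.X 𝒳 ≫ f) t) (2 * (p + B.dim))).hom ≤
      (algebraicClasses (fiberOver (snd B.X 𝒳 ≫ f) s) (p + B.dim)).comap
        (complexBetti.map (fiberι (snd B.X 𝒳 ≫ f) s) (2 * (p + B.dim))).hom) :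
    (algebraicClasses (fiberOver f t) p).comap (complexBetti.map (fiberι f t) (2 * p)).hom ≤
      (algebraicClasses (fiberOver f s) p).comap (complexBetti.map (fiberι f s) (2 * p)).hom := by
  haveI : IsProper S.hom := IsSmoothProjective.isProper_holds hf.isSmoothProjective_base
  exact comap_le_comap_of_snd_comp hf.isSmoothProjective_total hf.isSmoothProjectiveFamily
    (AbelianVariety.isSmoothProjective_holds (A := B)) (1 : B.Points ℂ) h

/-- Transport in degrees `2p > 2d` is trivially true. [folklore] -/
theorem comap_le_comap_of_dim_lt {d : ℕ} {f : 𝒳 ⟶ S} (hf : IsCompactAbelianPencil f d) (t s : ComplexPoints S) {p : ℕ}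
    (hdp : d < p) :
    (algebraicClasses (fiberOver f t) p).comap (complexBetti.map (fiberι f t) (2 * p)).hom ≤
      (algebraicClasses (fiberOver f s) p).comap (complexBetti.map (fiberι f s) (2 * p)).hom := by
  intro W _
  haveI := subsingleton_complexBetti (hf.isSmoothProjective_fiberOver s) (show 2 * d < 2 * p by omega)
  change complexBetti.map (fiberι f s) (2 * p) W ∈ algebraicClasses (fiberOver f s) p
  rw [Subsingleton.elim (complexBetti.map (fiberι f s) (2 * p) W) 0]
  exact Submodule.zero_mem _

/-- Transport in the divisorial degrees `p ≤ 1` is unconditional on a compact pencil (the lift `(L)_t(p)` holds there,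
part XXIX-d, and `ker j_t^* = ker j_s^*`). [cite: Lieberman1968, Thm. 1] [cite: Andre1996Motifs, §5.1 (p. 25)] -/
theorem comap_le_comap_of_le_one {d : ℕ} {f : 𝒳 ⟶ S} (hf : IsCompactAbelianPencil f d) (t s : ComplexPoints S) {p : ℕ}
    (hp : p ≤ 1) (hpd : p ≤ d) :
    (algebraicClasses (fiberOver f t) p).comap (complexBetti.map (fiberι f t) (2 * p)).hom ≤
      (algebraicClasses (fiberOver f s) p).comap (complexBetti.map (fiberι f s) (2 * p)).hom :=
  (comap_le_sup_of_extreme' hf t (q := d - p) (by omega) (Or.inl hp)).trans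
    ((algebraicClasses_sup_ker_eq hf p t s).le.trans (algebraicClasses_sup_ker_le_comap hf p s))

/-! ## §2 The lift nodes (L), (L∀) are their middle degree — FACT-FREE -/

/-- **`(L)^mid ⟹ (L)_t(p)` for `2p ≤ d`** at a CM point `t` of a compact pencil of relative dimension `d`: `p ≤ 1` is
part XXIX-d; `2p = d` is the hypothesis; for `2 ≤ p`, `2p < d` pad by a CM abelian variety `B` of dimension `d - 2p`
(`B × 𝒳_t` is again a CM fibre) and descend along part XXXII-a. FACT-FREE. [cite: Fulton1998, Prop. 1.7 and Thm. 6.2 (a)]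
[cite: Milne2020HodgeClassesAV, Prop. 1 (p. 7)] -/
theorem comap_le_sup_of_liftMid_of_two_mul_le (hmid : LiftMid[2]) {d : ℕ} {f : 𝒳 ⟶ S} (hf : IsCompactAbelianPencil f d)
    {t : ComplexPoints S} (ht : t ∈ cmLocus f d) {p : ℕ} (h2p : 2 * p ≤ d) :
    (algebraicClasses (fiberOver f t) p).comap (complexBetti.map (fiberι f t) (2 * p)).hom ≤
      algebraicClasses 𝒳 p ⊔ LinearMap.ker (complexBetti.map (fiberι f t) (2 * p)).hom := by
  rcases Nat.lt_or_ge p 2 with hp | hp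
  · exact comap_le_sup_of_extreme' hf t (q := d - p) (by omega) (Or.inl (by omega))
  rcases Nat.eq_or_lt_of_le h2p with heq | hlt
  · subst heq
    exact hmid f hf hp t ht
  · obtain ⟨B, hBd, hBcm⟩ := exists_isOfCMType_dim_eq_succ (d - 2 * p - 1)
    have hn : B.dim + d = 2 * (p + B.dim) := by omega
    exact comap_le_sup_of_snd_comp' hf B
      (hmid _ (isCompactAbelianPencil_snd_comp_of_eq hf B hn) (by omega) t (mem_cmLocus_snd_comp_of_eq f B hBcm hn ht))

/-- **`(L)^mid ⟹ (L)_t(p)` in EVERY degree** at a CM point: above the middle use part XXX-b (`(L)_t(q) ⟹ (L)_t(p)` for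
`p + q = d`, `q ≤ p`, Lieberman on the fibre); beyond `p > d` there is nothing to prove. FACT-FREE.
[cite: Kleiman1968AlgebraicCycles, §2 Thm. 2A11] [cite: Lieberman1968, Thm. 1] -/
theorem comap_le_sup_of_liftMid (hmid : LiftMid[2]) {d : ℕ} {f : 𝒳 ⟶ S} (hf : IsCompactAbelianPencil f d)
    {t : ComplexPoints S} (ht : t ∈ cmLocus f d) (p : ℕ) :
    (algebraicClasses (fiberOver f t) p).comap (complexBetti.map (fiberι f t) (2 * p)).hom ≤
      algebraicClasses 𝒳 p ⊔ LinearMap.ker (complexBetti.map (fiberι f t) (2 * p)).hom := by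
  rcases Nat.lt_or_ge d p with hdp | hpd
  · exact comap_le_sup_of_relDim_lt hf t hdp
  rcases Nat.lt_or_ge d (2 * p) with h2p | h2p
  · exact comap_le_sup_compl_of_le' hf t (show (d - p) + p = d by omega) (by omega)
      (comap_le_sup_of_liftMid_of_two_mul_le hmid hf ht (p := d - p) (by omega))
  · exact comap_le_sup_of_liftMid_of_two_mul_le hmid hf ht h2p

/-- **(L) ⟺ (L)^mid — `CMFibreAlgebraicLift` IS ITS MIDDLE DEGREE**, FACT-FREE: the specialisation surjectivity
`Aᵖ(𝒳) ↠ Aᵖ(𝒳_t)^{inv}` at CM fibres of all compact pencils of abelian varieties, in all degrees, is equivalent to the same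
for the MIDDLE-degree classes `H^{2m}` of the CM fibres of compact pencils of EVEN relative dimension `2m ≥ 4` — "find the
cycle on the `(2m+1)`-fold `𝒳` lifting a middle-dimensional invariant algebraic class of a CM fibre". Compare the spreading
axis (spread parts XXIV, XXXII): node-to-node only `F_CM ⟹ F_CM^mid` is fact-free there, the two agreeing instance-wise at and
above the middle by pull-back padding and differing only strictly below it; on THIS axis the nodes quantify over all pencils, so
the Gysin-padded pencil `B × 𝒳 ⟶ S` may be used in every degree. [cite: Milne2020HodgeClassesAV, Prop. 1 (p. 7)]
[cite: BrosnanFangNiePearlstein2009, §6 Lemma 48] [cite: Fulton1998, Prop. 1.7 and Thm. 6.2 (a)] -/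
theorem cmFibreAlgebraicLift_iff_liftMid : CMFibreAlgebraicLift ↔ LiftMid[2] :=
  ⟨fun h _ _ _ f hf _ t ht ↦ (cmFibreAlgebraicLift_iff_comap_le_sup.1 h) f hf _ t ht,
    fun h ↦ cmFibreAlgebraicLift_iff_comap_le_sup.2 fun _ _ _ _ hf p _ ht ↦ comap_le_sup_of_liftMid h hf ht p⟩

/-- **`(L∀)^mid ⟹ (L∀)` pointwise**: the algebraic fixed part in the middle degree of all compact pencils of even relative
dimension gives `(j_t^*)⁻¹ Nᵖ(𝒳_t) ≤ Nᵖ(𝒳) ⊔ ker j_t^*` at every point, every degree, every compact pencil. FACT-FREE.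
[cite: Milne2020HodgeClassesAV, Prop. 1 (p. 7)] [cite: Fulton1998, Prop. 1.7 and Thm. 6.2 (a)] -/
theorem comap_le_sup_of_fixedPartMid (hmid : FixedPartMid[2]) {d : ℕ} {f : 𝒳 ⟶ S} (hf : IsCompactAbelianPencil f d)
    (t : ComplexPoints S) (p : ℕ) :
    (algebraicClasses (fiberOver f t) p).comap (complexBetti.map (fiberι f t) (2 * p)).hom ≤
      algebraicClasses 𝒳 p ⊔ LinearMap.ker (complexBetti.map (fiberι f t) (2 * p)).hom := by
  -- below the middle
  have hlow : ∀ q : ℕ, 2 * q ≤ d →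
      (algebraicClasses (fiberOver f t) q).comap (complexBetti.map (fiberι f t) (2 * q)).hom ≤
        algebraicClasses 𝒳 q ⊔ LinearMap.ker (complexBetti.map (fiberι f t) (2 * q)).hom := by
    intro q h2q
    rcases Nat.lt_or_ge q 2 with hq | hq
    · exact comap_le_sup_of_extreme' hf t (q := d - q) (by omega) (Or.inl (by omega))
    rcases Nat.eq_or_lt_of_le h2q with heq | hlt
    · subst heq
      exact hmid f hf hq t
    · obtain ⟨B, hBd, -⟩ := exists_isOfCMType_dim_eq_succ (d - 2 * q - 1)
      have hn : B.dim + d = 2 * (q + B.dim) := by omega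
      exact comap_le_sup_of_snd_comp' hf B (hmid _ (isCompactAbelianPencil_snd_comp_of_eq hf B hn) (by omega) t)
  rcases Nat.lt_or_ge d p with hdp | hpd
  · exact comap_le_sup_of_relDim_lt hf t hdp
  rcases Nat.lt_or_ge d (2 * p) with h2p | h2p
  · exact comap_le_sup_compl_of_le' hf t (show (d - p) + p = d by omega) (by omega) (hlow (d - p) (by omega))
  · exact hlow p h2p

/-- **(L∀) ⟺ (L∀)^mid — `AlgebraicFixedPart` IS ITS MIDDLE DEGREE**, FACT-FREE (`⊇` of the lattice identity is always
true, part XVII-b `algebraicClasses_sup_ker_le_comap`). [cite: Milne2020HodgeClassesAV, Prop. 1 (p. 7)]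
[cite: BrosnanFangNiePearlstein2009, §6 Lemma 48] -/
theorem algebraicFixedPart_iff_fixedPartMid : AlgebraicFixedPart ↔ FixedPartMid[2] :=
  ⟨fun h _ _ _ f hf _ t ↦ ((algebraicFixedPart_iff_comap_eq_sup.1 h) f hf _ t).le,
    fun h ↦ algebraicFixedPart_iff_comap_eq_sup.2 fun _ _ _ _ hf p t ↦
      le_antisymm (comap_le_sup_of_fixedPartMid h hf t p) (algebraicClasses_sup_ker_le_comap hf p t)⟩

/-! ## §3 The transport nodes (4), (2), (3) are their middle degree — FACT-FREE -/

/-- **Transport below the middle from transport in the middle of the paddings** (anchor `t`, target `s` arbitrary): for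
`2p ≤ d`, transport from `t` to `s` in degree `2p` along `f` follows from transport from `t` to `s` in degree `2p` along `f`
itself when `2p = d`, and from transport in degree `2(p + dim B)` along `B × 𝒳 ⟶ S` for ONE CM abelian variety `B` with
`2p + dim B = d` otherwise (`p ≤ 1` being unconditional). FACT-FREE. [cite: Fulton1998, Prop. 1.7 and Thm. 6.2 (a)]
[cite: Abdulali1994FamiliesAV, (1.1) (p. 1122)] -/
theorem comap_le_comap_of_two_mul_le_of_pad {d : ℕ} {f : 𝒳 ⟶ S} (hf : IsCompactAbelianPencil f d) (t s : ComplexPoints S)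
    {p : ℕ} (h2p : 2 * p ≤ d)
    (hself : 2 ≤ p → 2 * p = d →
      (algebraicClasses (fiberOver f t) p).comap (complexBetti.map (fiberι f t) (2 * p)).hom ≤
        (algebraicClasses (fiberOver f s) p).comap (complexBetti.map (fiberι f s) (2 * p)).hom)
    (hpad : ∀ B : AbelianVariety ℂ, IsOfCMType B → 2 ≤ p → B.dim + d = 2 * (p + B.dim) →
      (algebraicClasses (fiberOver (snd B.X 𝒳 ≫ f) t) (p + B.dim)).comap
          (complexBetti.map (fiberι (snd B.X 𝒳 ≫ f) t) (2 * (p + B.dim))).hom ≤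
        (algebraicClasses (fiberOver (snd B.X 𝒳 ≫ f) s) (p + B.dim)).comap
          (complexBetti.map (fiberι (snd B.X 𝒳 ≫ f) s) (2 * (p + B.dim))).hom) :
    (algebraicClasses (fiberOver f t) p).comap (complexBetti.map (fiberι f t) (2 * p)).hom ≤
      (algebraicClasses (fiberOver f s) p).comap (complexBetti.map (fiberι f s) (2 * p)).hom := by
  rcases Nat.lt_or_ge p 2 with hp | hp
  · rcases Nat.lt_or_ge d p with hdp | hpd
    · exact comap_le_comap_of_dim_lt hf t s hdp
    · exact comap_le_comap_of_le_one hf t s (by omega) hpd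
  rcases Nat.eq_or_lt_of_le h2p with heq | hlt
  · exact hself hp heq
  · obtain ⟨B, hBd, hBcm⟩ := exists_isOfCMType_dim_eq_succ (d - 2 * p - 1)
    exact comap_le_comap_of_snd_comp' hf B (hpad B hBcm hp (by omega))

/-- **Transport in every degree from transport below the middle** (rational `(p,p)` form), on a compact pencil: above the
middle this is seat b02's LOWER SHADOW (`Ring2.Binders.map_fiberι_mem_algebraicClasses_of_lowerHalf`: one global
polarising class, the theorem of the fixed part, Lieberman's `B(𝒳_s)` — fact-free on quasi-projective carriers, which
compact pencils are). [cite: VoisinHodgeII2003, Thm. 4.18] [cite: Lieberman1968, main theorem] [cite: KerrPearlstein2011, §3.1] -/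
theorem map_fiberι_mem_algebraicClasses_of_lowHalf {d : ℕ} {f : 𝒳 ⟶ S} (hf : IsCompactAbelianPencil f d)
    {t : ComplexPoints S}
    (hlow : ∀ q : ℕ, 2 * q ≤ d → ∀ s : ComplexPoints S,
      (algebraicClasses (fiberOver f t) q).comap (complexBetti.map (fiberι f t) (2 * q)).hom ≤
        (algebraicClasses (fiberOver f s) q).comap (complexBetti.map (fiberι f s) (2 * q)).hom)
    (p : ℕ) (W : complexBetti 𝒳 (2 * p))
    (hW : ∀ s : ComplexPoints S, IsRationalClass (complexBetti.map (fiberι f s) (2 * p) W) ∧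
      IsOfHodgeType d (fiberOver f s) (2 * p) p p (complexBetti.map (fiberι f s) (2 * p) W))
    (h₀ : complexBetti.map (fiberι f t) (2 * p) W ∈ algebraicClasses (fiberOver f t) p) (s : ComplexPoints S) :
    complexBetti.map (fiberι f s) (2 * p) W ∈ algebraicClasses (fiberOver f s) p := by
  have hX := hf.isSmoothProjective_total
  have hSsp := hf.isSmoothProjective_base
  haveI : IrreducibleSpace S.left := Andre1996.compactPencil_irreducibleSpace_base hf
  have hA : ∀ s : ComplexPoints S, ∃ A' : AbelianVariety ℂ, A'.dim = d ∧ Nonempty (A'.X ≅ fiberOver f s) := fun s ↦ by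
    obtain ⟨A, ⟨e⟩⟩ := hf.exists_abelianVariety_fiber s
    exact ⟨A, Andre1996.compactPencil_dim_eq_of_iso hf e, ⟨e⟩⟩
  exact Binders.map_fiberι_mem_algebraicClasses_of_lowerHalf f hf.isSmoothProjectiveFamily
    (IsQuasiProjectiveOver.of_isProjectiveOver hX.isProjectiveOver)
    (IsQuasiProjectiveOver.of_isProjectiveOver hSsp.isProjectiveOver) (Andre1996.compactPencil_smooth_base hf) hA
    Set.univ (s₀ := t) (fun q h2q W' _ h₀' s' _ ↦ hlow q h2q s' h₀') p W hW h₀ s (Set.mem_univ s)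

/-- **(4) ⟺ (4)^mid — `CMAnchoredTransport` IS ITS MIDDLE DEGREE**, FACT-FREE: algebraicity spreads out of CM fibres on all
compact pencils in all degrees iff it does so for the MIDDLE-degree classes of compact pencils of even relative dimension
`2m ≥ 4` (below the middle: the padding of part XXXII-a; above: seat b02's lower shadow; `p ≤ 1`: parts XXIX–XXX).
Hence `B_min := (4)` of part I may be READ in the middle degree only. [cite: Andre1996Motifs, §6.3 a) (p. 33)]
[cite: Abdulali1994FamiliesAV, Lemma 6.2 (p. 1131)] [cite: BrosnanFangNiePearlstein2009, §6 Lemma 48] -/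
theorem cmAnchoredTransport_iff_transportMid : CMAnchoredTransport ↔ TransportMid[2] := by
  refine ⟨fun h m 𝒳 S f hf _ W t ht hW s ↦ (cmAnchoredTransport_iff_complex.1 h) f hf m W t ht hW s, fun hmid ↦ ?_⟩
  intro d 𝒳 S f hf p W hW t ht h₀ s
  refine map_fiberι_mem_algebraicClasses_of_lowHalf hf (t := t) (fun q h2q s' ↦ ?_) p W hW h₀ s
  refine comap_le_comap_of_two_mul_le_of_pad hf t s' h2q (fun hq heq ↦ ?_) (fun B hBcm hq hn ↦ ?_)
  · subst heq
    exact fun W' hW' ↦ hmid f hf hq W' t ht hW' s'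
  · exact fun W' hW' ↦ hmid _ (isCompactAbelianPencil_snd_comp_of_eq hf B hn) (by omega) W' t
      (mem_cmLocus_snd_comp_of_eq f B hBcm hn ht) hW' s'

/-- **(2) ⟺ (2)^mid — deform's `CompactAbelianPencilVHC` IS ITS MIDDLE DEGREE**, FACT-FREE (the compact-pencil, residual-free
twin of seat b02's `abelianSchemeVHC_iff_middleDegree_of_raynaud1970`, whose carriers are all abelian schemes over smooth
bases and whose padding is `pr^*(Kʳ ∪ W)`). [cite: Andre1996Motifs, §6.3 Remarque 2 (p. 33)] [cite: CharlesSchnell2014Notes, Cor. 11.3.6]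
[cite: BrosnanFangNiePearlstein2009, §6 Lemma 48] -/
theorem compactAbelianPencilVHC_iff_vhcMid : CompactAbelianPencilVHC ↔ VHCMid[2] := by
  refine ⟨fun h m 𝒳 S f hf _ W hW s ↦ (compactAbelianPencilVHC_iff_complex.1 h) f hf m W hW s, fun hmid ↦ ?_⟩
  intro d 𝒳 S f hf p W hW hs₀ s
  obtain ⟨t, h₀⟩ := hs₀
  refine map_fiberι_mem_algebraicClasses_of_lowHalf hf (t := t) (fun q h2q s' ↦ ?_) p W hW h₀ s
  refine comap_le_comap_of_two_mul_le_of_pad hf t s' h2q (fun hq heq ↦ ?_) (fun B _ hq hn ↦ ?_)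
  · subst heq
    exact fun W' hW' ↦ hmid f hf hq W' ⟨t, hW'⟩ s'
  · exact fun W' hW' ↦ hmid _ (isCompactAbelianPencil_snd_comp_of_eq hf B hn) (by omega) W' ⟨t, hW'⟩ s'

/-- **(3) ⟺ (3)^mid — `CMPointedPencilVHC` IS ITS MIDDLE DEGREE**, FACT-FREE (a CM point of `f` is a CM point of every
padding `B × 𝒳 ⟶ S` with `B` of CM type). [cite: Andre1996Motifs, Lemme 6.3.1 (p. 31) and Remarque 2 (p. 33)]
[cite: BrosnanFangNiePearlstein2009, §6 Lemma 48] -/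
theorem cmPointedPencilVHC_iff_pointedVHCMid : CMPointedPencilVHC ↔ PointedVHCMid[2] := by
  refine ⟨fun h m 𝒳 S f hf _ hne W hW s ↦ (cmPointedPencilVHC_iff_complex.1 h) f hf hne m W hW s, fun hmid ↦ ?_⟩
  intro d 𝒳 S f hf hne p W hW hs₀ s
  obtain ⟨t, h₀⟩ := hs₀
  obtain ⟨t₀, ht₀⟩ := hne
  refine map_fiberι_mem_algebraicClasses_of_lowHalf hf (t := t) (fun q h2q s' ↦ ?_) p W hW h₀ s
  refine comap_le_comap_of_two_mul_le_of_pad hf t s' h2q (fun hq heq ↦ ?_) (fun B hBcm hq hn ↦ ?_)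
  · subst heq
    exact fun W' hW' ↦ hmid f hf hq ⟨t₀, ht₀⟩ W' ⟨t, hW'⟩ s'
  · exact fun W' hW' ↦ hmid _ (isCompactAbelianPencil_snd_comp_of_eq hf B hn) (by omega)
      ⟨t₀, mem_cmLocus_snd_comp_of_eq f B hBcm hn ht₀⟩ W' ⟨t, hW'⟩ s'

end Summit.HodgeConjecture.HodgeConjecture.Ring2.AbelianAll

end
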